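import Summits.CriticalPhenomena.CardyFormulaZ2.Theorems.CardyBoundaryCoulombGasRectilinearCardyStubPointwiseFromEngineGPart1
import HarnessLib

/-!
# Line excursion-kernel-covariance of crux RectilinearCardy (stmt-CriticalPhenomena-5660), reshape c6-1, Part 1: the clockwise core from ONE MEMBER of the engine

Lead `prover-line-stmt-CriticalPhenomena-5660-c6-0`. The line is closed modulo its last stub, the
route's engine `BoundaryDefectGaussianR` (stmt-14132: ALL leg data `(k; L; j)`), and the implication
`BoundaryDefectGaussianR → RectilinearCardy` is landed (`DensityIntegration_proof`). But the engine is
APPLIED exactly once in the whole line (`pointwise_cw`, `…StubPointwiseFromEngineGPart1`), at the single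
leg datum `k = 4`, `L = (1,3,1,1)`, sink `j = 1`: three one-leg (boundary-condition-changing, weight `0`)
insertions at the marks `d, b, a` and the three-leg sink (weight `h(L) = L(L-1)/6 = 1`, the boundary
two-arm / closure-density insertion) at the moving point. Reshape c6-1 weakens the last stub to that
member. This file is `pointwise_cw` with the hypothesis `hE : BoundaryDefectGaussianR` replaced by the
member, stated verbatim as the specialisation of the route decl (so that `fun h ↦ h 4 ![1,3,1,1] 1 _`
proves `BoundaryDefectGaussianR →` member: `engineMember1311_of_engine` below); the proof is the landed one with its first line
(`obtain ⟨C₀, hC₀, hEng⟩ := hE 4 ![1, 3, 1, 1] 1 (by decide)`) replaced by the member's witness.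
-- adapted from Theorems/CardyBoundaryCoulombGasRectilinearCardyStubPointwiseFromEngineGPart1.lean (lead c3)
Sources: Baxter–Kelland–Wu 1976 §3–4 (collar / leg insertions); Cardy 1992 (the density form
`dP/dx ∝ |w′(x)| ∏_{p=a,b,d} |w(x)-w(p)|^{-2/3}` of the crossing formula); the line card
`Cruxes/RectilinearCardy/Lines/excursion-kernel-covariance.md`; `Cruxes/RectilinearCardy/PICKED.md` (c6).
-/

noncomputable section

open Set Filter Topology MeasureTheory Metric
open Literature.Probability.RandomPlanarGeometry
open Literature.Probability.LatticeModels (Site meshPoint zdGraph)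
open Summit.CriticalPhenomena.CardyFormulaZ2.Theorems.RectilinearCardy.Negative (IsRectilinear)
open Summit.CriticalPhenomena.CardyFormulaZ2.Theses.CardyBoundaryCoulombGas (BoundaryDefectGaussianR)
open Literature.Probability.LatticeModels.CollarLegModel (LegInsertionData Zins ofDomain)

namespace Summit.CriticalPhenomena.CardyFormulaZ2.Cruxes.RectilinearCardy.ExcursionKernelCovariance

/-! ### The member is the route's engine specialised -/

/-- The `(4; (1,3,1,1); 1)` member is LITERALLY the route decl `BoundaryDefectGaussianR` applied to
`k = 4`, `L = ![1,3,1,1]`, `j = 1` (the leg-balance side condition `L 1 = L 0 + L 2 + L 3`, i.e.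
`3 = 1 + 1 + 1`, holds by `decide`); in particular the full engine gives the member. [cite: BaxterKellandWu1976, §3–§4] -/
theorem engineMember1311_of_engine (h : BoundaryDefectGaussianR) :
    ∃ C : ℝ, 0 < C ∧ ∀ (D : MarkedDomain 4),
        (∃ S : Finset (ℂ × ℂ), (∀ p ∈ S, p.1.re = p.2.re ∨ p.1.im = p.2.im) ∧
          frontier D.carrier ⊆ ⋃ p ∈ S, segment ℝ p.1 p.2) →
        (∀ i, ∃ r : ℝ, 0 < r ∧
          ((∀ z ∈ frontier D.carrier, dist z (D.pt i) < r → z.im = (D.pt i).im) ∨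
            (∀ z ∈ frontier D.carrier, dist z (D.pt i) < r → z.re = (D.pt i).re))) →
        ∀ (w : ℂ → ℂ) (U : Set ℂ), IsOpen U → D.carrier ⊆ U → (∀ i, D.pt i ∈ U) →
          DifferentiableOn ℂ w U → Set.BijOn w D.carrier {z : ℂ | 0 < z.im} →
          (∀ i, ∃ ε : ℝ, 0 < ε ∧
            StrictMonoOn (fun t : ℝ ↦ (w (D.boundary t)).re) (Set.Ioo (D.mark i - ε) (D.mark i + ε))) →
          ∀ (δ : ℕ → ℝ), (∀ n, 0 < δ n) → Tendsto δ atTop (nhds 0) →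
          ∀ (V : ℕ → Finset (ℤ × ℤ)),
            (∀ n, ∀ v : ℤ × ℤ, v ∈ V n ↔
              ((v.1 : ℂ) * δ n + (v.2 : ℂ) * δ n * Complex.I) ∈ closure D.carrier) →
          ∀ (p : ℕ → Fin 4 → ℤ × ℤ), (∀ n, Function.Injective (p n)) →
            (∀ i, Tendsto (fun n ↦ ((p n i).1 : ℂ) * δ n + ((p n i).2 : ℂ) * δ n * Complex.I)
              atTop (nhds (D.pt i))) →
            (∀ n, LegInsertionData.IsAdmissible
              ⟨(Finset.univ.erase 1).image (p n),
                fun v ↦ ∑ i ∈ (Finset.univ.erase 1).filter (fun i ↦ p n i = v),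
                  (![1, 3, 1, 1] : Fin 4 → ℕ) i, p n 1⟩ (V n)) →
            Tendsto (fun n ↦ (δ n) ^ (-(∑ i : Fin 4,
                (if i = (1 : Fin 4) then (1 - ((![1, 3, 1, 1] : Fin 4 → ℕ) 1 : ℝ))
                  else ((![1, 3, 1, 1] : Fin 4 → ℕ) i : ℝ)) *
                  ((if i = (1 : Fin 4) then (1 - ((![1, 3, 1, 1] : Fin 4 → ℕ) 1 : ℝ))
                    else ((![1, 3, 1, 1] : Fin 4 → ℕ) i : ℝ)) - 1) / 6)) *
                ‖Zins (V n) ⟨(Finset.univ.erase 1).image (p n),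
                    fun v ↦ ∑ i ∈ (Finset.univ.erase 1).filter (fun i ↦ p n i = v),
                      (![1, 3, 1, 1] : Fin 4 → ℕ) i, p n 1⟩‖ / ‖(ofDomain (V n)).Z‖) atTop
              (nhds (C * (∏ i : Fin 4, ∏ i' ∈ Finset.univ.filter (fun i' : Fin 4 ↦ i < i'),
                  ‖w (D.pt i) - w (D.pt i')‖ ^
                    ((if i = (1 : Fin 4) then (1 - ((![1, 3, 1, 1] : Fin 4 → ℕ) 1 : ℝ))
                        else ((![1, 3, 1, 1] : Fin 4 → ℕ) i : ℝ)) *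
                      (if i' = (1 : Fin 4) then (1 - ((![1, 3, 1, 1] : Fin 4 → ℕ) 1 : ℝ))
                        else ((![1, 3, 1, 1] : Fin 4 → ℕ) i' : ℝ)) / 3)) *
                ∏ i : Fin 4, ‖deriv w (D.pt i)‖ ^
                  ((if i = (1 : Fin 4) then (1 - ((![1, 3, 1, 1] : Fin 4 → ℕ) 1 : ℝ))
                      else ((![1, 3, 1, 1] : Fin 4 → ℕ) i : ℝ)) *
                    ((if i = (1 : Fin 4) then (1 - ((![1, 3, 1, 1] : Fin 4 → ℕ) 1 : ℝ))
                      else ((![1, 3, 1, 1] : Fin 4 → ℕ) i : ℝ)) - 1) / 6))) :=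
  h 4 ![1, 3, 1, 1] 1 (by decide)

/-! ### The clockwise core from the `(4; (1,3,1,1); 1)` member of the engine -/

/-- **Clockwise core, member form.** For a CLOCKWISE rectilinear flat-marked `R` and a chart of the
Schwarz class whose boundary function DEcreases, the `(k = 4; L = (1,3,1,1); sink 1)` member of the
route's engine (alone) on the reversed mark-inserted domain `(Ω; d, ∂Ω(τ), b, a)` together with the
lattice bridge gives the pointwise closure-density law with constant `C₀ K`,
`K = (|w d - w b| |w d - w a| |w b - w a|)^{1/3}`. [cite: BaxterKellandWu1976, §3–§4] -/
theorem pointwise_cw_of_member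
    (hE : (∃ C : ℝ, 0 < C ∧ ∀ (D : MarkedDomain 4),
        (∃ S : Finset (ℂ × ℂ), (∀ p ∈ S, p.1.re = p.2.re ∨ p.1.im = p.2.im) ∧
          frontier D.carrier ⊆ ⋃ p ∈ S, segment ℝ p.1 p.2) →
        (∀ i, ∃ r : ℝ, 0 < r ∧
          ((∀ z ∈ frontier D.carrier, dist z (D.pt i) < r → z.im = (D.pt i).im) ∨
            (∀ z ∈ frontier D.carrier, dist z (D.pt i) < r → z.re = (D.pt i).re))) →
        ∀ (w : ℂ → ℂ) (U : Set ℂ), IsOpen U → D.carrier ⊆ U → (∀ i, D.pt i ∈ U) →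
          DifferentiableOn ℂ w U → Set.BijOn w D.carrier {z : ℂ | 0 < z.im} →
          (∀ i, ∃ ε : ℝ, 0 < ε ∧
            StrictMonoOn (fun t : ℝ ↦ (w (D.boundary t)).re) (Set.Ioo (D.mark i - ε) (D.mark i + ε))) →
          ∀ (δ : ℕ → ℝ), (∀ n, 0 < δ n) → Tendsto δ atTop (nhds 0) →
          ∀ (V : ℕ → Finset (ℤ × ℤ)),
            (∀ n, ∀ v : ℤ × ℤ, v ∈ V n ↔
              ((v.1 : ℂ) * δ n + (v.2 : ℂ) * δ n * Complex.I) ∈ closure D.carrier) →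
          ∀ (p : ℕ → Fin 4 → ℤ × ℤ), (∀ n, Function.Injective (p n)) →
            (∀ i, Tendsto (fun n ↦ ((p n i).1 : ℂ) * δ n + ((p n i).2 : ℂ) * δ n * Complex.I)
              atTop (nhds (D.pt i))) →
            (∀ n, LegInsertionData.IsAdmissible
              ⟨(Finset.univ.erase 1).image (p n),
                fun v ↦ ∑ i ∈ (Finset.univ.erase 1).filter (fun i ↦ p n i = v),
                  (![1, 3, 1, 1] : Fin 4 → ℕ) i, p n 1⟩ (V n)) →
            Tendsto (fun n ↦ (δ n) ^ (-(∑ i : Fin 4,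
                (if i = (1 : Fin 4) then (1 - ((![1, 3, 1, 1] : Fin 4 → ℕ) 1 : ℝ))
                  else ((![1, 3, 1, 1] : Fin 4 → ℕ) i : ℝ)) *
                  ((if i = (1 : Fin 4) then (1 - ((![1, 3, 1, 1] : Fin 4 → ℕ) 1 : ℝ))
                    else ((![1, 3, 1, 1] : Fin 4 → ℕ) i : ℝ)) - 1) / 6)) *
                ‖Zins (V n) ⟨(Finset.univ.erase 1).image (p n),
                    fun v ↦ ∑ i ∈ (Finset.univ.erase 1).filter (fun i ↦ p n i = v),
                      (![1, 3, 1, 1] : Fin 4 → ℕ) i, p n 1⟩‖ / ‖(ofDomain (V n)).Z‖) atTop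
              (nhds (C * (∏ i : Fin 4, ∏ i' ∈ Finset.univ.filter (fun i' : Fin 4 ↦ i < i'),
                  ‖w (D.pt i) - w (D.pt i')‖ ^
                    ((if i = (1 : Fin 4) then (1 - ((![1, 3, 1, 1] : Fin 4 → ℕ) 1 : ℝ))
                        else ((![1, 3, 1, 1] : Fin 4 → ℕ) i : ℝ)) *
                      (if i' = (1 : Fin 4) then (1 - ((![1, 3, 1, 1] : Fin 4 → ℕ) 1 : ℝ))
                        else ((![1, 3, 1, 1] : Fin 4 → ℕ) i' : ℝ)) / 3)) *
                ∏ i : Fin 4, ‖deriv w (D.pt i)‖ ^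
                  ((if i = (1 : Fin 4) then (1 - ((![1, 3, 1, 1] : Fin 4 → ℕ) 1 : ℝ))
                      else ((![1, 3, 1, 1] : Fin 4 → ℕ) i : ℝ)) *
                    ((if i = (1 : Fin 4) then (1 - ((![1, 3, 1, 1] : Fin 4 → ℕ) 1 : ℝ))
                      else ((![1, 3, 1, 1] : Fin 4 → ℕ) i : ℝ)) - 1) / 6)))))
    (hL :
      ∀ R : ConformalRectangle, IsRectilinear R → FlatMarks R →
        (∃ u : ℂ, (u = 1 ∨ u = Complex.I ∨ u = -1 ∨ u = -Complex.I) ∧ ∃ r : ℝ, 0 < r ∧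
          (∀ t t' : ℝ, R.mark 0 - r < t → t < t' → t' < R.mark 0 + r →
            0 < ((R.boundary t' - R.boundary t) / u).re ∧ ((R.boundary t' - R.boundary t) / u).im = 0) ∧
          (∀ z : ℂ, dist z (R.pt 0) < r →
            (z ∈ R.carrier ↔ 0 < -((z - R.pt 0) / u).im))) →
        ∀ σ σ' : ℝ, AdmissibleRange R σ σ' → ∀ τ ∈ Icc σ σ',
          ∀ (δ : ℕ → ℝ), (∀ n, 0 < δ n) → Tendsto δ atTop (𝓝 0) →
          ∀ (v : ℕ → Site 2), (∀ n, v n ∈ boundaryRow R (δ n)) →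
            Tendsto (fun n => meshPoint (δ n) (v n)) atTop (𝓝 (R.boundary τ)) →
            ∃ p : ℕ → Fin 4 → ℤ × ℤ,
              (∀ i : Fin 4, Tendsto (fun n => ((p n i).1 : ℂ) * δ n + ((p n i).2 : ℂ) * δ n * Complex.I)
                atTop (𝓝 ((![R.pt 3, R.boundary τ, R.pt 1, R.pt 0] : Fin 4 → ℂ) i))) ∧
              (∀ᶠ n in atTop, Function.Injective (p n) ∧
                LegInsertionData.IsAdmissible
                  (⟨(Finset.univ.erase 1).image (p n),
                    fun x ↦ ∑ i ∈ (Finset.univ.erase 1).filter (fun i ↦ p n i = x),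
                      (![1, 3, 1, 1] : Fin 4 → ℕ) i, p n 1⟩ : LegInsertionData)
                  ((closureFinset R (δ n)).image fun x : Site 2 => (x 0, x 1))) ∧
              ∀ ε : ℝ, 0 < ε → ∀ᶠ n in atTop,
                |‖Zins ((closureFinset R (δ n)).image fun x : Site 2 => (x 0, x 1))
                    (⟨(Finset.univ.erase 1).image (p n),
                      fun x ↦ ∑ i ∈ (Finset.univ.erase 1).filter (fun i ↦ p n i = x),
                        (![1, 3, 1, 1] : Fin 4 → ℕ) i, p n 1⟩ : LegInsertionData)‖ /
                    ‖(ofDomain ((closureFinset R (δ n)).image fun x : Site 2 => (x 0, x 1))).Z‖ -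
                  closureDensity R (δ n) (v n)| ≤ ε * δ n)
    (R : ConformalRectangle) (hR : IsRectilinear R) (hF : FlatMarks R)
    (hcw : ∃ u : ℂ, (u = 1 ∨ u = Complex.I ∨ u = -1 ∨ u = -Complex.I) ∧ ∃ r : ℝ, 0 < r ∧
        (∀ t t' : ℝ, R.mark 0 - r < t → t < t' → t' < R.mark 0 + r →
          0 < ((R.boundary t' - R.boundary t) / u).re ∧ ((R.boundary t' - R.boundary t) / u).im = 0) ∧
        (∀ z : ℂ, dist z (R.pt 0) < r → (z ∈ R.carrier ↔ 0 < -((z - R.pt 0) / u).im)))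
    (U : Set ℂ) (w : ℂ → ℂ) (hUo : IsOpen U) (hΩU : R.carrier ⊆ U)
    (h0U : R.pt 0 ∈ U) (h1U : R.pt 1 ∈ U) (h3U : R.pt 3 ∈ U)
    (hwd : DifferentiableOn ℂ w U) (hwbij : BijOn w R.carrier {z : ℂ | 0 < z.im})
    (g : ℝ → ℝ) (S₀ S : ℝ) (hS₀ : S₀ < 0) (h3S : R.mark 3 < S) (hg : StrictAntiOn g (Icc S₀ S))
    (hwg : ∀ t ∈ Icc S₀ S, R.boundary t ∈ U → w (R.boundary t) = g t) :
    ∃ C : ℝ, 0 < C ∧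
      ∀ σ σ' : ℝ, AdmissibleRange R σ σ' → R.boundary '' Icc σ σ' ⊆ U →
        (∀ τ ∈ Icc σ σ', w (R.boundary τ) ≠ w (R.pt 0) ∧ w (R.boundary τ) ≠ w (R.pt 1) ∧
          w (R.boundary τ) ≠ w (R.pt 3)) →
        ∀ τ ∈ Icc σ σ', ∀ (δ : ℕ → ℝ), (∀ n, 0 < δ n) → Tendsto δ atTop (𝓝 0) →
          ∀ (v : ℕ → Site 2), (∀ n, v n ∈ boundaryRow R (δ n)) →
            Tendsto (fun n => meshPoint (δ n) (v n)) atTop (𝓝 (R.boundary τ)) →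
            Tendsto (fun n => closureDensity R (δ n) (v n) / δ n) atTop
              (𝓝 (C * (‖deriv w (R.boundary τ)‖ *
                (‖w (R.boundary τ) - w (R.pt 0)‖ ^ 2 * ‖w (R.boundary τ) - w (R.pt 1)‖ ^ 2 *
                    ‖w (R.boundary τ) - w (R.pt 3)‖ ^ 2) ^ (-(1 / 3 : ℝ))))) := by
  -- the member's witness
  obtain ⟨C₀, hC₀, hEng⟩ := hE
  -- marks and their order
  have hm01 : R.mark 0 < R.mark 1 := R.strictMono_mark (show (0 : Fin 4) < 1 by decide)
  have hm13 : R.mark 1 < R.mark 3 := R.strictMono_mark (show (1 : Fin 4) < 3 by decide)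
  have hm0 : 0 ≤ R.mark 0 := (R.mark_mem 0).1
  have hm3 : R.mark 3 < 1 := (R.mark_mem 3).2
  -- the chart's values at the marks are `g (mark i)`
  have hw0 : w (R.pt 0) = g (R.mark 0) := hwg _ ⟨by linarith, by linarith⟩ h0U
  have hw1 : w (R.pt 1) = g (R.mark 1) := hwg _ ⟨by linarith, by linarith⟩ h1U
  have hw3 : w (R.pt 3) = g (R.mark 3) := hwg _ ⟨by linarith, by linarith⟩ h3U
  -- the source constant `K > 0`
  set K : ℝ := (‖w (R.pt 3) - w (R.pt 1)‖ * ‖w (R.pt 3) - w (R.pt 0)‖ * ‖w (R.pt 1) - w (R.pt 0)‖) ^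
    (1 / 3 : ℝ) with hK
  have hK0 : 0 < K := by
    have hI0 : R.mark 0 ∈ Icc S₀ S := ⟨by linarith, by linarith⟩
    have hI1 : R.mark 1 ∈ Icc S₀ S := ⟨by linarith, by linarith⟩
    have hI3 : R.mark 3 ∈ Icc S₀ S := ⟨by linarith, by linarith⟩
    have h31 : w (R.pt 3) ≠ w (R.pt 1) := by
      rw [hw3, hw1]; exact_mod_cast (hg hI1 hI3 hm13).ne
    have h30 : w (R.pt 3) ≠ w (R.pt 0) := by
      rw [hw3, hw0]; exact_mod_cast (hg hI0 hI3 (hm01.trans hm13)).ne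
    have h10 : w (R.pt 1) ≠ w (R.pt 0) := by
      rw [hw1, hw0]; exact_mod_cast (hg hI0 hI1 hm01).ne
    apply Real.rpow_pos_of_pos
    exact mul_pos (mul_pos (norm_pos_iff.2 (sub_ne_zero.2 h31)) (norm_pos_iff.2 (sub_ne_zero.2 h30)))
      (norm_pos_iff.2 (sub_ne_zero.2 h10))
  refine ⟨C₀ * K, mul_pos hC₀ hK0, ?_⟩
  intro σ σ' hadm hwinU hsep τ hτ δ hδ hδ0 v hv hvx
  obtain ⟨h1σ, hσσ', hσ'3, rw, hrw, hflatwin⟩ := hadm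
  have h1τ : R.mark 1 < τ := by linarith [hτ.1]
  have hτ3 : τ < R.mark 3 := by linarith [hτ.2]
  have hxU : R.boundary τ ∈ U := hwinU ⟨τ, hτ, rfl⟩
  obtain ⟨hx0, hx1, hx3⟩ := hsep τ hτ
  -- the reversed mark-inserted domain `(Ω; d, x, b, a)`
  obtain ⟨D, hDc, hDb, hDm⟩ := stub_reverseInsert R τ h1τ hτ3
  have hD0 : D.pt 0 = R.pt 3 := by
    show D.boundary (D.mark 0) = R.boundary (R.mark 3)
    rw [hDb, hDm]; congr 1
    show R.mark 0 + R.mark 3 - R.mark 0 = R.mark 3; ring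
  have hD1 : D.pt 1 = R.boundary τ := by
    show D.boundary (D.mark 1) = R.boundary τ
    rw [hDb, hDm]; congr 1
    show R.mark 0 + R.mark 3 - (R.mark 0 + R.mark 3 - τ) = τ; ring
  have hD2 : D.pt 2 = R.pt 1 := by
    show D.boundary (D.mark 2) = R.boundary (R.mark 1)
    rw [hDb, hDm]; congr 1
    show R.mark 0 + R.mark 3 - (R.mark 0 + R.mark 3 - R.mark 1) = R.mark 1; ring
  have hD3 : D.pt 3 = R.pt 0 := by
    show D.boundary (D.mark 3) = R.boundary (R.mark 0)
    rw [hDb, hDm]; congr 1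
    show R.mark 0 + R.mark 3 - R.mark 3 = R.mark 0; ring
  have hDpt : ∀ i, D.pt i = (![R.pt 3, R.boundary τ, R.pt 1, R.pt 0] : Fin 4 → ℂ) i := by
    intro i
    fin_cases i
    · exact hD0
    · exact hD1
    · exact hD2
    · exact hD3
  -- the engine's hypotheses for `D`
  have hErect : ∃ S : Finset (ℂ × ℂ), (∀ p ∈ S, p.1.re = p.2.re ∨ p.1.im = p.2.im) ∧
      frontier D.carrier ⊆ ⋃ p ∈ S, segment ℝ p.1 p.2 := by
    rw [hDc]; exact hR
  have hEflat : ∀ i : Fin 4, ∃ r : ℝ, 0 < r ∧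
      ((∀ z ∈ frontier D.carrier, dist z (D.pt i) < r → z.im = (D.pt i).im) ∨
        (∀ z ∈ frontier D.carrier, dist z (D.pt i) < r → z.re = (D.pt i).re)) := by
    intro i
    rw [hDc, hDpt i]
    fin_cases i
    · exact hF 3
    · exact ⟨rw, hrw, hflatwin τ hτ⟩
    · exact hF 1
    · exact hF 0
  have hEU : ∀ i : Fin 4, D.pt i ∈ U := by
    intro i
    rw [hDpt i]
    fin_cases i
    · exact h3U
    · exact hxU
    · exact h1U
    · exact h0U
  have hEsub : D.carrier ⊆ U := by rw [hDc]; exact hΩU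
  have hEbij : BijOn w D.carrier {z : ℂ | 0 < z.im} := by rw [hDc]; exact hwbij
  have hEmono : ∀ i : Fin 4, ∃ ε : ℝ, 0 < ε ∧
      StrictMonoOn (fun t : ℝ => (w (D.boundary t)).re) (Ioo (D.mark i - ε) (D.mark i + ε)) := by
    have key : ∀ (i : Fin 4) (s : ℝ), S₀ < s → s < S → R.boundary s ∈ U →
        D.mark i = R.mark 0 + R.mark 3 - s → ∃ ε : ℝ, 0 < ε ∧
          StrictMonoOn (fun t : ℝ => (w (D.boundary t)).re) (Ioo (D.mark i - ε) (D.mark i + ε)) := by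
      intro i s hs0 hs1 hsU hmi
      obtain ⟨ε, hε, hmono⟩ := strictMonoOn_re_reversed R hUo hg hwg (R.mark 0 + R.mark 3) hs0 hs1 hsU
      refine ⟨ε, hε, ?_⟩
      rw [hmi]
      simpa only [hDb] using hmono
    intro i
    fin_cases i
    · exact key 0 (R.mark 3) (by linarith) h3S h3U (by rw [hDm]; show R.mark 0 = _; ring)
    · exact key 1 τ (by linarith) (by linarith) hxU (by rw [hDm]; rfl)
    · exact key 2 (R.mark 1) (by linarith) (by linarith) h1U (by rw [hDm]; rfl)
    · exact key 3 (R.mark 0) (by linarith) (by linarith) h0U (by rw [hDm]; show R.mark 3 = _; ring)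
  -- the lattice bridge on `R` (clockwise), then shift the sequences to be admissible from the start
  obtain ⟨p, hpconv, hpev, hpo⟩ :=
    hL R hR hF hcw σ σ' ⟨h1σ, hσσ', hσ'3, rw, hrw, hflatwin⟩ τ hτ δ hδ hδ0 v hv hvx
  obtain ⟨N, hN⟩ := eventually_atTop.1 hpev
  set δ' : ℕ → ℝ := fun k => δ (k + N) with hδ'
  set p' : ℕ → Fin 4 → ℤ × ℤ := fun k => p (k + N) with hp'
  set V' : ℕ → Finset (ℤ × ℤ) := fun k =>
    (closureFinset R (δ' k)).image (fun x : Site 2 => (x 0, x 1)) with hV'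
  have hδ'pos : ∀ k, 0 < δ' k := fun k => hδ _
  have hδ'0 : Tendsto δ' atTop (𝓝 0) := hδ0.comp (tendsto_add_atTop_nat N)
  have hV'mem : ∀ (k : ℕ) (u : ℤ × ℤ), u ∈ V' k ↔
      ((u.1 : ℂ) * δ' k + (u.2 : ℂ) * δ' k * Complex.I) ∈ closure D.carrier := by
    intro k u
    rw [hDc]
    exact mem_image_closureFinset_iff R (hδ'pos k) u
  have hp'inj : ∀ k, Function.Injective (p' k) := fun k => (hN (k + N) le_add_self).1
  have hp'adm : ∀ k, LegInsertionData.IsAdmissible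
      (⟨(Finset.univ.erase 1).image (p' k),
        fun x ↦ ∑ i ∈ (Finset.univ.erase 1).filter (fun i ↦ p' k i = x),
          (![1, 3, 1, 1] : Fin 4 → ℕ) i, p' k 1⟩ : LegInsertionData) (V' k) :=
    fun k => (hN (k + N) le_add_self).2
  have hp'conv : ∀ i : Fin 4, Tendsto
      (fun k => ((p' k i).1 : ℂ) * δ' k + ((p' k i).2 : ℂ) * δ' k * Complex.I) atTop (𝓝 (D.pt i)) := by
    intro i
    rw [hDpt i]
    exact (hpconv i).comp (tendsto_add_atTop_nat N)
  have hlim := hEng D hErect hEflat w U hUo hEsub hEU hwd hEbij hEmono δ' hδ'pos hδ'0 V' hV'mem p'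
    hp'inj hp'conv hp'adm
  -- read the engine's limit through the chart algebra: normalisation `δ⁻¹`, value `C₀ K Φ_w(x)`
  obtain ⟨-, hXb, hXc⟩ := stub_chartAlgebra
  have hval := hXb w D.pt C₀ (by rw [hD1, hD0]; exact hx3) (by rw [hD1, hD2]; exact hx1)
    (by rw [hD1, hD3]; exact hx0)
  rw [hval] at hlim
  rw [hD0, hD1, hD2, hD3] at hlim
  have hlim' : Tendsto (fun k => (δ' k)⁻¹ *
      ‖Zins (V' k) (⟨(Finset.univ.erase 1).image (p' k),
        fun x ↦ ∑ i ∈ (Finset.univ.erase 1).filter (fun i ↦ p' k i = x),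
          (![1, 3, 1, 1] : Fin 4 → ℕ) i, p' k 1⟩ : LegInsertionData)‖ / ‖(ofDomain (V' k)).Z‖) atTop
      (𝓝 (C₀ * K * (‖deriv w (R.boundary τ)‖ *
        (‖w (R.boundary τ) - w (R.pt 0)‖ ^ 2 * ‖w (R.boundary τ) - w (R.pt 1)‖ ^ 2 *
          ‖w (R.boundary τ) - w (R.pt 3)‖ ^ 2) ^ (-(1 / 3 : ℝ))))) := by
    refine (hlim.congr fun k => ?_)
    rw [hXc _ (hδ'pos k)]
  -- the bridge's `o(δ)` comparison transfers the limit to `closureDensity / δ`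
  have hdiff : Tendsto (fun k => closureDensity R (δ' k) (v (k + N)) / δ' k - (δ' k)⁻¹ *
      ‖Zins (V' k) (⟨(Finset.univ.erase 1).image (p' k),
        fun x ↦ ∑ i ∈ (Finset.univ.erase 1).filter (fun i ↦ p' k i = x),
          (![1, 3, 1, 1] : Fin 4 → ℕ) i, p' k 1⟩ : LegInsertionData)‖ / ‖(ofDomain (V' k)).Z‖)
      atTop (𝓝 0) := by
    rw [Metric.tendsto_nhds]
    intro ε hε
    have hev := (tendsto_add_atTop_nat N).eventually (hpo (ε / 2) (half_pos hε))
    filter_upwards [hev] with k hk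
    rw [Real.dist_0_eq_abs]
    have hδk : 0 < δ' k := hδ'pos k
    have hrew : closureDensity R (δ' k) (v (k + N)) / δ' k - (δ' k)⁻¹ *
        ‖Zins (V' k) (⟨(Finset.univ.erase 1).image (p' k),
          fun x ↦ ∑ i ∈ (Finset.univ.erase 1).filter (fun i ↦ p' k i = x),
            (![1, 3, 1, 1] : Fin 4 → ℕ) i, p' k 1⟩ : LegInsertionData)‖ / ‖(ofDomain (V' k)).Z‖ =
        -((‖Zins (V' k) (⟨(Finset.univ.erase 1).image (p' k),
          fun x ↦ ∑ i ∈ (Finset.univ.erase 1).filter (fun i ↦ p' k i = x),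
            (![1, 3, 1, 1] : Fin 4 → ℕ) i, p' k 1⟩ : LegInsertionData)‖ / ‖(ofDomain (V' k)).Z‖ -
          closureDensity R (δ' k) (v (k + N))) / δ' k) := by
      field_simp
      ring
    rw [hrew, abs_neg, abs_div, abs_of_pos hδk, div_lt_iff₀ hδk]
    calc _ ≤ ε / 2 * δ' k := hk
      _ < ε * δ' k := by nlinarith
  have hsum := hlim'.add hdiff
  rw [add_zero] at hsum
  rw [← tendsto_add_atTop_iff_nat N]
  refine hsum.congr fun k => ?_
  show _ = closureDensity R (δ' k) (v (k + N)) / δ' k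
  ring

end Summit.CriticalPhenomena.CardyFormulaZ2.Cruxes.RectilinearCardy.ExcursionKernelCovariance

end
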